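import Mathlib.Data.Fintype.Perm
import Literature.Computability.AlgebraicComplexity.HasNSRefutation
import Literature.Computability.Complexity.SumOfSquaresSymmetry
import HarnessLib

/-!
# `S_r`-symmetric Positivstellensatz certificates for Brent systems

Topic `Literature/Computability/AlgebraicComplexity`, on top of `BrentEquations.lean`
(`brentSystem K n r`, the Brent system `B(n, r)` of `⟨n,n,n⟩`) and
`Complexity/SumOfSquaresSymmetry.lean` (invariant SOS certificates suffice under a finite group
permuting variables and equations; Gatermann–Parrilo 2004, Thm. 3.3).

The symmetric group `S_r` relabels the `r` rank-one terms of a decomposition: it acts on the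
unknowns `X (s, t, e)` of `B(n, r)` through the product index `t` (`brentSlotPerm`) and fixes every
Brent polynomial (`rename_brentSlotPerm_brentSystem`: the sum over `t` is symmetric). Hence
(`HasSOSRefutation.exists_slotSymmetric`), in characteristic `0`, a static SOS refutation of
`B(n, r)` of half-degree `d` may be taken `S_r`-invariant (sum of squares invariant, multipliers
individually invariant) — the soundness of restricting certificate searches for `B_ℝ(3,19)`,
`B_ℝ(2,6)`, … to `S_r`-invariant Gram matrices (route MatrixMultiplication/BrentRefutationDepth,
"the symmetry-reduction soundness lemma (invariant certificates suffice)").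

## References

* K. Gatermann, P. A. Parrilo, *Symmetry groups, semidefinite programs, and sums of squares*,
  J. Pure Appl. Algebra 192 (2004) 95–128, Thm. 3.3. [GatermannParrilo2004]
* M. J. H. Heule, M. Kauers, M. Seidl, *New ways to multiply 3 × 3-matrices*, J. Symbolic
  Comput. 104 (2021), §2 (the Brent equations). [HeuleKauersSeidl2021]
-/

noncomputable section

/-! ### Application: `S_r`-symmetric certificates for Brent systems -/

namespace Literature.Computability.AlgebraicComplexity

open MvPolynomial Literature.Computability.Complexity

/-- The symmetric group `S_r` acts on the unknowns `X (s, t, e)` of the Brent system `B(n, r)` by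
permuting the product index `t` (relabelling the `r` rank-one terms). [folklore] -/
def brentSlotPerm (n r : ℕ) : Equiv.Perm (Fin r) →* Equiv.Perm (Fin 3 × Fin r × (Fin n × Fin n)) where
  toFun τ := Equiv.prodCongr (Equiv.refl (Fin 3)) (Equiv.prodCongr τ (Equiv.refl (Fin n × Fin n)))
  map_one' := by
    ext ⟨a, t, i⟩ <;> rfl
  map_mul' τ τ' := by
    ext ⟨a, t, i⟩ <;> rfl

/-- `brentSlotPerm` moves only the product index. [folklore] -/
@[simp] theorem brentSlotPerm_apply (n r : ℕ) (τ : Equiv.Perm (Fin r))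
    (p : Fin 3 × Fin r × (Fin n × Fin n)) : brentSlotPerm n r τ p = (p.1, τ p.2.1, p.2.2) := rfl

variable (K : Type*) [CommRing K]

/-- Every Brent polynomial is invariant under relabelling the products: the sum over `t` is
symmetric. [cite: HeuleKauersSeidl2021, §2 (the Brent equations)] -/
theorem rename_brentSlotPerm_brentSystem (n r : ℕ) (τ : Equiv.Perm (Fin r)) (i j k : Fin n × Fin n) :
    rename (brentSlotPerm n r τ) (brentSystem K n r i j k) = brentSystem K n r i j k := by
  simp only [brentSystem_apply, map_sub, map_sum, map_mul, rename_X, rename_C, brentSlotPerm_apply]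
  congr 1
  exact Equiv.sum_comp τ (fun t => X ((0 : Fin 3), t, i) * X ((1 : Fin 3), t, j) * X ((2 : Fin 3), t, k))

variable {K}

/-- **`S_r`-symmetric SOS certificates suffice for Brent systems.** Over a field of characteristic
`0`, if `B_K(n, r)` has a static Positivstellensatz refutation of half-degree `d`, then it has one
of half-degree `d` whose sum of squares is invariant under every relabelling of the `r` products and
whose multipliers are individually invariant (`HasSOSRefutation.exists_invariant_rename` with the
trivial action on the equation index). Justifies restricting certificate searches for
`B_ℝ(3,19)`, `B_ℝ(2,6)`, … to `S_r`-invariant Gram matrices. [cite: GatermannParrilo2004, Thm. 3.3] -/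
theorem HasSOSRefutation.exists_slotSymmetric {K : Type*} [Field K] [CharZero K] {n r d : ℕ}
    (H : HasSOSRefutation
      (fun e : (Fin n × Fin n) × (Fin n × Fin n) × (Fin n × Fin n) =>
        brentSystem K n r e.1 e.2.1 e.2.2) d) :
    ∃ (m : ℕ) (q : Fin m → MvPolynomial (Fin 3 × Fin r × (Fin n × Fin n)) K)
      (g : (Fin n × Fin n) × (Fin n × Fin n) × (Fin n × Fin n) →
        MvPolynomial (Fin 3 × Fin r × (Fin n × Fin n)) K),
      (∀ l, (q l).totalDegree ≤ d) ∧
      (∀ e, (g e * brentSystem K n r e.1 e.2.1 e.2.2).totalDegree ≤ 2 * d) ∧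
      (∑ l, q l * q l) + ∑ e, g e * brentSystem K n r e.1 e.2.1 e.2.2 = -1 ∧
      (∀ τ : Equiv.Perm (Fin r), rename (brentSlotPerm n r τ) (∑ l, q l * q l) = ∑ l, q l * q l) ∧
      (∀ (τ : Equiv.Perm (Fin r)) e, rename (brentSlotPerm n r τ) (g e) = g e) := by
  have hcard : (Fintype.card (Equiv.Perm (Fin r)) : K) ≠ 0 :=
    Nat.cast_ne_zero.2 Fintype.card_ne_zero
  obtain ⟨m, q, g, hq, hg, hsum, hinv, heq⟩ :=
    H.exists_invariant_rename (brentSlotPerm n r) (1 : Equiv.Perm (Fin r) →* Equiv.Perm _)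
      (fun τ e => by simp [rename_brentSlotPerm_brentSystem]) hcard
  exact ⟨m, q, g, hq, hg, hsum, hinv, fun τ e => by simpa using heq τ e⟩

end Literature.Computability.AlgebraicComplexity

end
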